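import Literature.AlgebraicGeometry.ModuliOfAbelianVarieties.SiegelFineModuliSchemeLevelQuotientUniqueness
import Literature.AlgebraicGeometry.AbelianSchemes.PolarizedTripleIsBaseChangeViaFpqcGlue
import Literature.AlgebraicGeometry.AbelianSchemes.PolarizedTripleRigidityDescent
import HarnessLib

/-!
# The classifying map to a level quotient of a fine moduli carrier CLASSIFIES
# ([MumfordFogartyKirwan1994] Ch. 7 §3 pp. 139–142: `A_{g,d,n}/Γ` represents the coarser level functor — the relation
# `Y ≅ f^* X_{M/Γ}` and the `classify` field of the quotient carrier)

Topic `AlgebraicGeometry/ModuliOfAbelianVarieties`; namespaces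
`Literature.AlgebraicGeometry.AbelianSchemes.PolarizedAbelianSchemeWithLevel` (§1) and
`Literature.AlgebraicGeometry.ModuliOfAbelianVarieties.SiegelFineModuliScheme` (§2–§3).  THEOREMS ONLY (no definition, no
named fact, no instance, no notation, no `sorry`; net Literature debt 0).  Cell `hodgecm-mathlib` (D-0151), F-DAG F-10 (b)
TAIL, brick **(b2′) PROPER** — «the relation `Y.IsBaseChangeVia X_Q f G Ĝ` for the DESCENDED classifying map» (signature
sheet `B-provers/B-p06/g11/F10b-CENSUS-SKELETON.B-p06g11.md` Addendum 4; author B-p14 (g18)).  Count-neutral capital;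
HC_CM is proved only modulo the 7 printed citations until rung 0 closes — nothing here is about HC.

SETTING (the binders of ★ `hom_ext_of_isBaseChangeVia_levelQuotient`, B-p02).  `𝓜` a fine moduli carrier of level
`N = N₀ d` (★ `SiegelFineModuliScheme`), `p : M → Q` a `ℚ`-morphism killed by the twist operators of `K_δ(N₀)` (`hp`, the
currency of ★ `existsUnique_desc_classifyingMap_left_comp`), and `X` a level-`N₀` triple over `Q` of which the
level-`N₀` reduction `𝒰.changeLevel N₀` of the universal triple is the pull-back along `p` (the descended universal triple
of (10a); (Q) and (10a)-on-`Q` supply `p`, `hp`, `X`, `hX` — here they are HYPOTHESES).  CLAIM ([MumfordFogartyKirwan1994]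
Ch. 7 §3, proof of «`A_{g,d,n}/Γ` is the coarser moduli scheme», pp. 139–142; [Lan2013PELCompactifications] Rem. 1.4.1.9):
every level-`N₀` triple `Y` over a locally Noetherian `ℚ`-scheme `T` IS the pull-back of `X` along its descended
classifying map `f : T → Q` (★ `exists_desc_classifyingMap`: `c ≫ f = classifyingMap P₁ ≫ p` for a finite étale
refinement `(T₁, c, P₁)` of `Y`).  PROOF: over `T₁` the level-`N₀` reduction of `P₁` is a pull-back of `Y` along `c`
(the refinement datum) AND a pull-back of `X` along `classifyingMap P₁ ≫ p = c ≫ f` (★ `IsBaseChangeVia.changeLevel`,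
`.trans`); level-`N₀ ≥ 3` triples are rigid over every locally Noetherian `ℚ`-scheme (★
`eq_id_and_hat_eq_id_of_three_le`, B-p03 — unconditional), so the comparison maps DESCEND along the fpqc covering `c`
(★ `exists_isBaseChangeVia_of_isBaseChangeVia_of_flat_surjective`, [GortzWedhorn2020] Thm. 14.72) to `(G, Ĝ)`
exhibiting `Y` as the pull-back of `X` along `f`.

* §1 `PolarizedAbelianSchemeWithLevel.exists_isBaseChangeVia_of_changeLevel_of_flat_surjective` — the generic core over a
  `ℚ`-scheme: pull-back relations to a level quotient `(U ↦ X along p)` DESCEND along an fpqc covering `c : T₁ → T`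
  locally of finite type through any `m : T₁ → M` with `P₁ ≅ m^* U`, `(P₁.changeLevel N₀) ≅ c^* Y` and `c ≫ f = m ≫ p`
  (no moduli carrier, no classifying map: `M`, `U`, `p`, `X`, `m` are arbitrary).
* §2 `SiegelFineModuliScheme.exists_isBaseChangeVia_of_desc_classifyingMap` — **(b2′)**: the descended classifying map
  `f₁` of ANY fpqc refinement datum `(T₁, c₁, P₁)` of `Y` classifies: `∃ G Ĝ, Y.IsBaseChangeVia X f₁ G Ĝ`;
  `exists_hom_isBaseChangeVia_levelQuotient` — EXISTENCE of a `ℚ`-morphism `f : T → Q` with `Y ≅ f^* X`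
  (★ `exists_desc_classifyingMap` + §2; `f` is a `ℚ`-morphism because `c₁` is an epimorphism, Mathlib
  `Flat.epi_of_flat_of_surjective`).
* §3 `SiegelFineModuliScheme.existsUnique_hom_isBaseChangeVia_levelQuotient` — THE `classify` FIELD OF THE LEVEL-`N₀`
  CARRIER ON `Q` verbatim (`∃! f : T ⟶ Q, ∃ G Ĝ, Y.IsBaseChangeVia X f.left G Ĝ`): existence §2, uniqueness ★
  `hom_ext_of_isBaseChangeVia_levelQuotient` (B-p02 (b3)); consumed by (pack).

NOT here: the quotient `Q = M/Δ` itself ((Q)), its étaleness ((Q-free)), the descended triple `X` ((10a)-on-`Q`), the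
packaging (pack).

## References
* [MumfordFogartyKirwan1994] D. Mumford, J. Fogarty, F. Kirwan, *Geometric Invariant Theory*, 3rd ed. (1994), Ch. 7 §3
  (pp. 139–140; pp. 140–142), Ch. 7 §2 Definition 7.2 (p. 129), Proposition 7.6 (pp. 136–138).
* [Lan2013PELCompactifications] K.-W. Lan, *Arithmetic compactifications of PEL-type Shimura varieties* (2013), §1.4.1
  Remark 1.4.1.9 (p. 90).
* [GortzWedhorn2020] U. Görtz, T. Wedhorn, *Algebraic Geometry I*, 2nd ed. (2020), Thm. 14.72 (fpqc descent of morphisms).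
* [Deligne1971TravauxShimura] P. Deligne, *Travaux de Shimura*, Sém. Bourbaki 389 (1971), 4.16 (p. 150).
-/

noncomputable section

-- the `Over`-category structure maps of ★ `changeLevel` / `baseChange` are not reducible (as in ★ `PolarizedTripleIsBaseChangeViaFpqcGlue`).
set_option backward.isDefEq.respectTransparency false

open CategoryTheory CategoryTheory.Limits AlgebraicGeometry
open scoped MonObj

namespace Literature.AlgebraicGeometry.AbelianSchemes.PolarizedAbelianSchemeWithLevel

open AbelianSchemeOver

variable {g N N₀ d : ℕ} {δ : Fin g → ℕ}

/-! ### §1 Pull-back relations to a level quotient descend along fpqc coverings of a `ℚ`-scheme -/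

/-- **PULL-BACK RELATIONS TO A LEVEL QUOTIENT DESCEND ALONG fpqc COVERINGS** (the generic core of F-10 (b2′),
[MumfordFogartyKirwan1994] Ch. 7 §3 pp. 139–142 with Prop. 7.6: for `n ≥ 3` pull-back data are unique, hence descend;
[GortzWedhorn2020] Thm. 14.72).  Data: a level-`N` triple `U` over `M` (`N = N₀ d`), a map `p : M → Q₀` and a level-`N₀`
triple `X` over `Q₀` with `U.changeLevel N₀ ≅ p^* X` via `(π, π̂)`; a level-`N₀` triple `Y` over a locally Noetherian
`ℚ`-scheme `T`; an fpqc covering `c : T₁ → T` locally of finite type (`T₁` locally Noetherian) and a level-`N` triple `P₁`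
over `T₁` with `P₁.changeLevel N₀ ≅ c^* Y` via `(G₁, Ĝ₁)` and `P₁ ≅ m^* U` via `(Gm, Ĝm)` for some `m : T₁ → M`; a map
`f : T → Q₀` with `c ≫ f = m ≫ p`.  THEN `Y ≅ f^* X` via `(G, Ĝ)` with `G₁ ≫ G = Gm ≫ π`, `Ĝ₁ ≫ Ĝ = Ĝm ≫ π̂`: over `T₁`,
`P₁.changeLevel N₀` is a pull-back of `X` along `m ≫ p = c ≫ f` (★ `IsBaseChangeVia.changeLevel`, `.trans`), and since
level-`N₀ ≥ 3` triples are rigid at every geometric point of `T` (★ `eq_id_and_hat_eq_id_of_three_le`) the comparison maps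
descend along `c` (★ `exists_isBaseChangeVia_of_isBaseChangeVia_of_flat_surjective`; `T₁ ×_T T₁` is locally Noetherian by
Mathlib `LocallyOfFiniteType.isLocallyNoetherian`).
[cite: MumfordFogartyKirwan1994, Ch. 7 §3 (pp. 139–140)] [cite: MumfordFogartyKirwan1994, Ch. 7 §2 Proposition 7.6 (pp. 136–138)]
[cite: GortzWedhorn2020, Thm. 14.72] -/
theorem exists_isBaseChangeVia_of_changeLevel_of_flat_surjective (hd : N = N₀ * d) (hN : N ≠ 0) (hN₀ : 3 ≤ N₀)
    {M Q₀ T T₁ : Scheme.{0}} (sT : T ⟶ Spec (.of ℚ)) [IsLocallyNoetherian T] [IsLocallyNoetherian T₁]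
    {U : PolarizedAbelianSchemeWithLevel g N δ M} {X : PolarizedAbelianSchemeWithLevel g N₀ δ Q₀} {p : M ⟶ Q₀}
    {π : (U.changeLevel N₀ d hd hN).A.X.left ⟶ X.A.X.left}
    {πh : (U.changeLevel N₀ d hd hN).D.hat.X.left ⟶ X.D.hat.X.left}
    (hX : (U.changeLevel N₀ d hd hN).IsBaseChangeVia X p π πh)
    {Y : PolarizedAbelianSchemeWithLevel g N₀ δ T} (c : T₁ ⟶ T) [Flat c] [Surjective c] [QuasiCompact c]
    [LocallyOfFiniteType c] {P₁ : PolarizedAbelianSchemeWithLevel g N δ T₁}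
    {G₁ : (P₁.changeLevel N₀ d hd hN).A.X.left ⟶ Y.A.X.left}
    {Ĝ₁ : (P₁.changeLevel N₀ d hd hN).D.hat.X.left ⟶ Y.D.hat.X.left}
    (hY₁ : (P₁.changeLevel N₀ d hd hN).IsBaseChangeVia Y c G₁ Ĝ₁) {m : T₁ ⟶ M}
    {Gm : P₁.A.X.left ⟶ U.A.X.left} {Ĝm : P₁.D.hat.X.left ⟶ U.D.hat.X.left} (hm : P₁.IsBaseChangeVia U m Gm Ĝm)
    {f : T ⟶ Q₀} (hf : c ≫ f = m ≫ p) :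
    ∃ (G : Y.A.X.left ⟶ X.A.X.left) (Ĝ : Y.D.hat.X.left ⟶ X.D.hat.X.left),
      G₁ ≫ G = Gm ≫ π ∧ Ĝ₁ ≫ Ĝ = Ĝm ≫ πh ∧ Y.IsBaseChangeVia X f G Ĝ := by
  -- `T₁ ×_T T₁` is locally Noetherian (locally of finite type over the locally Noetherian `T₁`)
  haveI : IsLocallyNoetherian (pullback c c) := LocallyOfFiniteType.isLocallyNoetherian (pullback.fst c c)
  -- level-`N₀ ≥ 3` triples are rigid at every geometric point of the `ℚ`-scheme `T` (B-p03, unconditional)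
  have hT : ∀ ⦃Ω : Type⦄ [Field Ω] [IsAlgClosed Ω] (t : Spec (.of Ω) ⟶ T)
      (R : PolarizedAbelianSchemeWithLevel g N₀ δ (Spec (.of Ω))) (H : R.A.X.left ⟶ R.A.X.left)
      (Ĥ : R.D.hat.X.left ⟶ R.D.hat.X.left), R.IsBaseChangeVia R (𝟙 _) H Ĥ → H = 𝟙 _ :=
    fun Ω _ _ t R H Ĥ h => (eq_id_and_hat_eq_id_of_three_le (t ≫ sT) hN₀ R h).1
  -- over `T₁`: `P₁.changeLevel N₀` is a pull-back of `X` along `m ≫ p = c ≫ f`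
  have h₁ := (hm.changeLevel N₀ d hd hN).trans hX
  rw [← hf] at h₁
  exact exists_isBaseChangeVia_of_isBaseChangeVia_of_flat_surjective (P := X) (f := f) hT c hY₁ h₁

end Literature.AlgebraicGeometry.AbelianSchemes.PolarizedAbelianSchemeWithLevel

namespace Literature.AlgebraicGeometry.ModuliOfAbelianVarieties

open Literature.AlgebraicGeometry.Motives (SchemeOver)
open Literature.AlgebraicGeometry.AbelianSchemes (PolarizedAbelianSchemeWithLevel)
open Literature.AlgebraicGeometry.AbelianSchemes.AbelianSchemeOver
open Literature.NumberTheory.Adeles NumberField IsDedekindDomain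

namespace SiegelFineModuliScheme

variable {g N : ℕ} {δ : Fin g → ℕ} (𝓜 : SiegelFineModuliScheme g N δ) [IsCommMonObj 𝓜.univ.A.X] [NeZero N]

/-! ### §2 (b2′): the descended classifying map classifies -/

omit [IsCommMonObj 𝓜.univ.A.X] in
/-- **(b2′) THE DESCENDED CLASSIFYING MAP CLASSIFIES** ([MumfordFogartyKirwan1994] Ch. 7 §3 pp. 139–142;
[Lan2013PELCompactifications] Rem. 1.4.1.9): `X` a level-`N₀` triple over `Q` with `𝒰.changeLevel N₀ ≅ p^* X`
(`N = N₀ d`, `N₀ ≥ 3`), `Y` a level-`N₀` triple over a locally Noetherian `ℚ`-scheme `T`, `(T₁, c₁, P₁)` an fpqc refinement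
datum of `Y` (`c₁` flat, surjective, quasi-compact, locally of finite type; `P₁.changeLevel N₀ ≅ c₁^* Y`) and
`f₁ : T → Q` its descended classifying map (`c₁ ≫ f₁ = classifyingMap P₁ ≫ p`, ★ `exists_desc_classifyingMap` /
`existsUnique_desc_classifyingMap_left_comp`).  THEN `Y ≅ f₁^* X`: §1 with `m := classifyingMap P₁`
(★ `exists_isBaseChangeVia_classifyingMap`).
[cite: MumfordFogartyKirwan1994, Ch. 7 §3 (pp. 139–140)] [cite: Lan2013PELCompactifications, §1.4.1 Remark 1.4.1.9 (p. 90)] -/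
theorem exists_isBaseChangeVia_of_desc_classifyingMap {N₀ d : ℕ} (hd : N = N₀ * d) (hN₀ : 3 ≤ N₀)
    {Q T T₁ : SchemeOver ℚ} [IsLocallyNoetherian T.left] [IsLocallyNoetherian T₁.left] (p : 𝓜.M ⟶ Q)
    (X : PolarizedAbelianSchemeWithLevel g N₀ δ Q.left)
    {π : (𝓜.univ.changeLevel N₀ d hd (NeZero.ne N)).A.X.left ⟶ X.A.X.left}
    {πh : (𝓜.univ.changeLevel N₀ d hd (NeZero.ne N)).D.hat.X.left ⟶ X.D.hat.X.left}
    (hX : (𝓜.univ.changeLevel N₀ d hd (NeZero.ne N)).IsBaseChangeVia X p.left π πh)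
    {Y : PolarizedAbelianSchemeWithLevel g N₀ δ T.left} (c₁ : T₁ ⟶ T) [Surjective c₁.left] [Flat c₁.left]
    [QuasiCompact c₁.left] [LocallyOfFiniteType c₁.left] (P₁ : PolarizedAbelianSchemeWithLevel g N δ T₁.left)
    {G₁ : (P₁.changeLevel N₀ d hd (NeZero.ne N)).A.X.left ⟶ Y.A.X.left}
    {Ĝ₁ : (P₁.changeLevel N₀ d hd (NeZero.ne N)).D.hat.X.left ⟶ Y.D.hat.X.left}
    (hY₁ : (P₁.changeLevel N₀ d hd (NeZero.ne N)).IsBaseChangeVia Y c₁.left G₁ Ĝ₁)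
    (f₁ : T.left ⟶ Q.left) (hf₁ : c₁.left ≫ f₁ = (𝓜.classifyingMap T₁ P₁).left ≫ p.left) :
    ∃ (G : Y.A.X.left ⟶ X.A.X.left) (Ĝ : Y.D.hat.X.left ⟶ X.D.hat.X.left), Y.IsBaseChangeVia X f₁ G Ĝ := by
  obtain ⟨Gm, Ĝm, hm⟩ := 𝓜.exists_isBaseChangeVia_classifyingMap T₁ P₁
  obtain ⟨G, Ĝ, -, -, h⟩ :=
    PolarizedAbelianSchemeWithLevel.exists_isBaseChangeVia_of_changeLevel_of_flat_surjective hd (NeZero.ne N) hN₀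
      T.hom hX c₁.left hY₁ hm hf₁
  exact ⟨G, Ĝ, h⟩

/-- **EXISTENCE OF THE CLASSIFYING MAP TO THE LEVEL QUOTIENT** ([MumfordFogartyKirwan1994] Ch. 7 §3 pp. 139–142: the
existence half of «`A_{g,d,n}/Γ` represents the coarser level functor»; [Lan2013PELCompactifications] Rem. 1.4.1.9):
`p : M → Q` a `ℚ`-morphism killed by the twist operators of `K_δ(N₀)`, `X` a level-`N₀` triple over `Q` with
`𝒰.changeLevel N₀ ≅ p^* X` (`N₀ ≥ 3`); then every level-`N₀` triple `Y` over a locally Noetherian `ℚ`-scheme `T` is the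
pull-back of `X` along SOME `ℚ`-morphism `f : T → Q` — the descended classifying map of a finite étale refinement of `Y`
(★ `exists_desc_classifyingMap`), which classifies by `exists_isBaseChangeVia_of_desc_classifyingMap` and is a
`ℚ`-morphism because the refining cover is an epimorphism (Mathlib `Flat.epi_of_flat_of_surjective`).
[cite: MumfordFogartyKirwan1994, Ch. 7 §3 (pp. 139–140)] [cite: Lan2013PELCompactifications, §1.4.1 Remark 1.4.1.9 (p. 90)] -/
theorem exists_hom_isBaseChangeVia_levelQuotient (hδ : IsPolarizationType δ) (hg : 0 < g)
    {N₀ d : ℕ} [NeZero N₀] (hd : N = N₀ * d) (hN₀ : 3 ≤ N₀) {Q T : SchemeOver ℚ} [IsLocallyNoetherian T.left]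
    (p : 𝓜.M ⟶ Q)
    (hp : ∀ r : gspFinAdelic δ, r ∈ principalLevelSubgroup δ N₀ → ∀ GN : GL (Fin g ⊕ Fin g) (ZMod N),
      (∀ (i j : Fin g ⊕ Fin g)
        (h : ((r : GL (Fin g ⊕ Fin g) finAdeleQ) : Matrix (Fin g ⊕ Fin g) (Fin g ⊕ Fin g) finAdeleQ) i j ∈
          FiniteAdeleRing.integralAdeles (𝓞 ℚ) ℚ),
        (GN : Matrix (Fin g ⊕ Fin g) (Fin g ⊕ Fin g) (ZMod N)) i j = integralAdeleResidue N ⟨_, h⟩) →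
      ∀ hs : (𝓜.univ.level.twist GN).IsSymplecticLiftable 𝓜.univ.pol δ,
        (haveI := 𝓜.isLocallyNoetherian
         (𝓜.classifyingMap 𝓜.M ({ 𝓜.univ with level := 𝓜.univ.level.twist GN, symplectic := hs } :
           PolarizedAbelianSchemeWithLevel g N δ 𝓜.M.left)).left) ≫ p.left = p.left)
    (X : PolarizedAbelianSchemeWithLevel g N₀ δ Q.left)
    {π : (𝓜.univ.changeLevel N₀ d hd (NeZero.ne N)).A.X.left ⟶ X.A.X.left}
    {πh : (𝓜.univ.changeLevel N₀ d hd (NeZero.ne N)).D.hat.X.left ⟶ X.D.hat.X.left}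
    (hX : (𝓜.univ.changeLevel N₀ d hd (NeZero.ne N)).IsBaseChangeVia X p.left π πh)
    (Y : PolarizedAbelianSchemeWithLevel g N₀ δ T.left) :
    ∃ (f : T ⟶ Q) (G : Y.A.X.left ⟶ X.A.X.left) (Ĝ : Y.D.hat.X.left ⟶ X.D.hat.X.left),
      Y.IsBaseChangeVia X f.left G Ĝ := by
  have hd0 : d ≠ 0 := fun h => NeZero.ne N (by rw [hd, h, Nat.mul_zero])
  subst hd
  -- a finite étale refinement of `Y` with its descended classifying map `f₁`
  obtain ⟨T₁, c₁, _, P₁, G₁, Ĝ₁, f₁, hfin, het, hsurj, hY₁, hf₁⟩ := 𝓜.exists_desc_classifyingMap hδ hg hd0 T Y p.left hp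
  haveI := hfin
  haveI := het
  haveI := hsurj
  obtain ⟨G, Ĝ, h⟩ := 𝓜.exists_isBaseChangeVia_of_desc_classifyingMap rfl hN₀ p X hX c₁ P₁ hY₁ f₁ hf₁
  -- `f₁` is a `ℚ`-morphism: test after the epimorphism `c₁`
  haveI : Epi c₁.left := Flat.epi_of_flat_of_surjective _
  have hw : f₁ ≫ Q.hom = T.hom := by
    rw [← cancel_epi c₁.left, reassoc_of% hf₁, Over.w p, Over.w (𝓜.classifyingMap T₁ P₁), Over.w c₁]
  exact ⟨Over.homMk f₁ hw, G, Ĝ, h⟩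

/-! ### §3 The `classify` field of the level-`N₀` carrier on the quotient -/

/-- **THE LEVEL QUOTIENT IS A FINE MODULI CARRIER FOR LEVEL `N₀` — its `classify` field verbatim**
([MumfordFogartyKirwan1994] Ch. 7 §3 pp. 139–142: «`A_{g,d,n}/Γ` is the fine moduli scheme of the coarser level problem»;
[Lan2013PELCompactifications] Rem. 1.4.1.9, Cor. 1.4.1.12): `p : M → Q` an fpqc cover (flat, surjective, quasi-compact,
locally of finite type — e.g. the finite étale quotient by the free level-kernel action) killed by the twist operators of
`K_δ(N₀)`, `X` a level-`N₀` triple over `Q` with `𝒰.changeLevel N₀ ≅ p^* X` (`N₀ ≥ 3`); then for every level-`N₀` triple `Y`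
over a locally Noetherian `ℚ`-scheme `T` there is a UNIQUE `ℚ`-morphism `f : T → Q` with `Y ≅ f^* X` — existence
`exists_hom_isBaseChangeVia_levelQuotient`, uniqueness ★ `hom_ext_of_isBaseChangeVia_levelQuotient` (B-p02).  This is the
`classify` field of `SiegelFineModuliScheme g N₀ δ` on `⟨Q, X⟩` ((pack)).
[cite: MumfordFogartyKirwan1994, Ch. 7 §3 (pp. 139–140)] [cite: Lan2013PELCompactifications, §1.4.1 Remark 1.4.1.9 (p. 90)] -/
theorem existsUnique_hom_isBaseChangeVia_levelQuotient (hδ : IsPolarizationType δ) (hg : 0 < g)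
    {N₀ d : ℕ} [NeZero N₀] (hd : N = N₀ * d) (hN₀ : 3 ≤ N₀) {Q T : SchemeOver ℚ} [IsLocallyNoetherian T.left]
    (p : 𝓜.M ⟶ Q) [Surjective p.left] [Flat p.left] [QuasiCompact p.left] [LocallyOfFiniteType p.left]
    (hp : ∀ r : gspFinAdelic δ, r ∈ principalLevelSubgroup δ N₀ → ∀ GN : GL (Fin g ⊕ Fin g) (ZMod N),
      (∀ (i j : Fin g ⊕ Fin g)
        (h : ((r : GL (Fin g ⊕ Fin g) finAdeleQ) : Matrix (Fin g ⊕ Fin g) (Fin g ⊕ Fin g) finAdeleQ) i j ∈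
          FiniteAdeleRing.integralAdeles (𝓞 ℚ) ℚ),
        (GN : Matrix (Fin g ⊕ Fin g) (Fin g ⊕ Fin g) (ZMod N)) i j = integralAdeleResidue N ⟨_, h⟩) →
      ∀ hs : (𝓜.univ.level.twist GN).IsSymplecticLiftable 𝓜.univ.pol δ,
        (haveI := 𝓜.isLocallyNoetherian
         (𝓜.classifyingMap 𝓜.M ({ 𝓜.univ with level := 𝓜.univ.level.twist GN, symplectic := hs } :
           PolarizedAbelianSchemeWithLevel g N δ 𝓜.M.left)).left) ≫ p.left = p.left)
    (X : PolarizedAbelianSchemeWithLevel g N₀ δ Q.left)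
    {π : (𝓜.univ.changeLevel N₀ d hd (NeZero.ne N)).A.X.left ⟶ X.A.X.left}
    {πh : (𝓜.univ.changeLevel N₀ d hd (NeZero.ne N)).D.hat.X.left ⟶ X.D.hat.X.left}
    (hX : (𝓜.univ.changeLevel N₀ d hd (NeZero.ne N)).IsBaseChangeVia X p.left π πh)
    (Y : PolarizedAbelianSchemeWithLevel g N₀ δ T.left) :
    ∃! f : T ⟶ Q, ∃ (G : Y.A.X.left ⟶ X.A.X.left) (Ĝ : Y.D.hat.X.left ⟶ X.D.hat.X.left),
      Y.IsBaseChangeVia X f.left G Ĝ := by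
  obtain ⟨f, G, Ĝ, h⟩ := 𝓜.exists_hom_isBaseChangeVia_levelQuotient hδ hg hd hN₀ p hp X hX Y
  refine ⟨f, ⟨G, Ĝ, h⟩, fun f' hf' => ?_⟩
  obtain ⟨G', Ĝ', h'⟩ := hf'
  exact 𝓜.hom_ext_of_isBaseChangeVia_levelQuotient hδ hg hd p hp X hX f' f h' h

end SiegelFineModuliScheme

end Literature.AlgebraicGeometry.ModuliOfAbelianVarieties

end
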